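import Summits.QuantumAdvantage.QuantumAdvantage.Theorems.LinnikCubicClassGroupsDegreeOnePrimesEscapeQuinticS5Group32
import Summits.QuantumAdvantage.QuantumAdvantage.Theorems.LinnikCubicClassGroupsDegreeOnePrimesEscapeSymmetricOneSided
import HarnessLib

/-!
# Every `S₅`-quintic field has a prime of splitting type `(2,3)` below `|d_K|^L`, unconditionally

Topic `Summits/QuantumAdvantage/QuantumAdvantage/Theorems`, cell B2b-1 (linnik-cubic), PART A (gen 8);
helper toward the crux `DegreeOnePrimesEscape` (stmt-QuantumAdvantage-11543) of route
`LinnikCubicClassGroups`.  HONEST FRAMING: the value of this file is a THEOREM (kernel-checked, GRH-free,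
Siegel-free, no hypothesis) — NOT summit progress.

**Theorem** (`exists_splittingType_two_three_le_of_quintic_S5`).  There is `L > 0` such that every
quintic number field all of whose Galois splitting fields have degree `≥ 120` (Galois closure `S₅`) has
a prime `p ≤ |d_K|^L`, `p ∤ d_K`, with `p𝓞_K = 𝔭₂𝔭₃` (Frobenius of cycle type `(3,2)`; density `1/6`):
the instance `n = 5`, `C = (3,2)` of `exists_frobenius_mem_of_oneSided_symmetric` with the data
`exists_quintic32_data`.  Only upper bounds for four auxiliary subfields and the prime number theorem
are used.  Placement: existence with explicit exponent known (LMO 1979; Cho–Lemke Oliver–Zaman 2025,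
Thm 8); new here is the kernel-checked proof with an inexplicit exponent.

References: J. C. Lagarias, H. L. Montgomery, A. M. Odlyzko, Invent. Math. 54 (1979)
[LagariasMontgomeryOdlyzko1979]; R. Perlis, J. Number Theory 9 (1977) [Perlis1977].
-/

noncomputable section

open scoped NumberField nonZeroDivisors
open Finset Real Ideal NumberField Equiv Equiv.Perm
open Literature.NumberTheory.NumberFields Literature.NumberTheory.LFunctions
  Literature.NumberTheory.LFunctions.NumberField

namespace Summit.QuantumAdvantage.QuantumAdvantage.Theorems.DegreeOnePrimesEscape

/-! ### The theorem -/

/-- **Splitting type `(2,3)` from the Frobenius fixed-point data**: for a number field of degree `5`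
and a prime `p ∤ d_K`, if no prime above `p` has residue degree `1` and `Σ_{𝔭 ∣ p, f ∣ 2} f = 2` then
`T_K(p) = {2, 3}`. -/
theorem splittingType_eq_two_three {K : Type*} [Field K] [NumberField K] (h5 : Module.finrank ℚ K = 5)
    {p : ℕ} (hp : p.Prime) (hd : ¬ (p : ℤ) ∣ NumberField.discr K)
    (h1 : ((splittingType K p).filter (· ∣ 1)).sum = 0)
    (h2 : ((splittingType K p).filter (· ∣ 2)).sum = 2) :
    splittingType K p = {2, 3} := by
  classical
  set T := splittingType K p with hT
  have hsum : T.sum = 5 := by rw [hT, sum_splittingType_eq_finrank hp hd, h5]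
  have hpos : ∀ f ∈ T, 0 < f := fun f hf => splittingType_pos hp hf
  -- no `1`
  have hno1 : (1 : ℕ) ∉ T := fun h => by
    have hmem : 1 ∈ T.filter (· ∣ 1) := Multiset.mem_filter.mpr ⟨h, dvd_refl 1⟩
    have := Multiset.le_sum_of_mem hmem
    omega
  -- exactly one `2`
  have hfilt2 : T.filter (· ∣ 2) = T.filter (· = 2) :=
    Multiset.filter_congr fun f hf => by
      constructor
      · intro hf2
        have hle := Nat.le_of_dvd (by norm_num) hf2
        have h0 := hpos f hf
        have hne1 : f ≠ 1 := fun h => hno1 (h ▸ hf)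
        interval_cases f
        · exact absurd rfl hne1
        · rfl
      · rintro rfl; exact dvd_refl 2
  have hcount : T.count 2 = 1 := by
    rw [hfilt2, Multiset.filter_eq', Multiset.sum_replicate, smul_eq_mul] at h2
    omega
  -- the rest `T' = T ∖ {2}` has sum `3` and elements `≥ 3`, so `T' = {3}`
  set T' := T.filter (· ≠ 2) with hT'
  have hdecomp : T = {2} + T' := by
    have h := (Multiset.filter_add_not (· = 2) T).symm
    rw [Multiset.filter_eq', hcount] at h
    exact h
  have hT'sum : T'.sum = 3 := by
    have := congrArg Multiset.sum hdecomp
    rw [Multiset.sum_add, Multiset.sum_singleton, hsum] at this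
    omega
  have hge3 : ∀ f ∈ T', 3 ≤ f := by
    intro f hf
    rw [hT', Multiset.mem_filter] at hf
    have h0 := hpos f hf.1
    have hne1 : f ≠ 1 := fun h => hno1 (h ▸ hf.1)
    omega
  have hcard : Multiset.card T' = 1 := by
    have hle : 3 * Multiset.card T' ≤ T'.sum := by
      have := Multiset.card_nsmul_le_sum hge3
      simpa [smul_eq_mul, mul_comm] using this
    rcases Nat.lt_or_ge (Multiset.card T') 2 with h | h
    · interval_cases hc : Multiset.card T'
      · rw [Multiset.card_eq_zero] at hc
        rw [hc, Multiset.sum_zero] at hT'sum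
        exact absurd hT'sum (by norm_num)
      · rfl
    · omega
  obtain ⟨a, ha⟩ := Multiset.card_eq_one.mp hcard
  have ha3 : a = 3 := by rw [ha, Multiset.sum_singleton] at hT'sum; exact hT'sum
  rw [hdecomp, ha, ha3, Multiset.singleton_add]
  rfl

/-- `1 < 5`. -/
private theorem one_lt_five' : 1 < 5 := by norm_num

set_option maxHeartbeats 800000 in
/-- **A prime of splitting type `(2,3)` in every `S₅`-quintic field, unconditionally**: there is
`L > 0` such that every quintic number field `K` all of whose Galois splitting fields have degree
`≥ 120` has a prime `p ≤ |d_K|^{L}`, `p ∤ d_K`, with `T_K(p) = {2, 3}` (Frobenius of cycle type `(3,2)`).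
GRH-free, Siegel-free; proved with upper bounds only. [cite: LagariasMontgomeryOdlyzko1979, Theorem 1.1] -/
theorem exists_splittingType_two_three_le_of_quintic_S5 :
    ∃ L : ℝ, 0 < L ∧ ∀ (K : Type) [Field K] [NumberField K], Module.finrank ℚ K = 5 →
      (∀ (M : Type) [Field M] [NumberField M] [IsGalois ℚ M],
        (K →ₐ[ℚ] M) → Nat.factorial 5 ≤ Module.finrank ℚ M) →
        ∃ p : ℕ, p.Prime ∧ (p : ℝ) ≤ ((NumberField.discr K).natAbs : ℝ) ^ L ∧
          ¬ ((p : ℤ) ∣ NumberField.discr K) ∧ splittingType K p = {2, 3} := by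
  classical
  obtain ⟨H, hH, hpt⟩ := exists_quintic32_data
  have hpt' : ∀ y : Perm (Fin 5), ((12 : ℕ) : ℝ) ≤
      ∑ i, (Nat.card {q : Perm (Fin 5) // q * y * q⁻¹ ∈ H i} : ℝ) / Nat.card (H i) +
        (if y ∈ ({y : Perm (Fin 5) | (Finset.univ.filter fun i : Fin 5 => y i = i).card = 0 ∧
            (Finset.univ.filter fun i : Fin 5 => (y ^ 2) i = i).card = 2} : Set (Perm (Fin 5)))
          then ((12 : ℕ) : ℝ) else 0) := by
    intro y
    have key := hpt y
    have e12 : ((12 : ℕ) : ℝ) = 12 := by norm_num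
    rw [e12]
    by_cases hy : (Finset.univ.filter fun i : Fin 5 => y i = i).card = 0 ∧
        (Finset.univ.filter fun i : Fin 5 => (y ^ 2) i = i).card = 2
    · rw [if_pos hy] at key
      have hy' : y ∈ ({y : Perm (Fin 5) | (Finset.univ.filter fun i : Fin 5 => y i = i).card = 0 ∧
          (Finset.univ.filter fun i : Fin 5 => (y ^ 2) i = i).card = 2} : Set (Perm (Fin 5))) := hy
      rw [if_pos hy']
      exact key
    · rw [if_neg hy] at key
      have hy' : y ∉ ({y : Perm (Fin 5) | (Finset.univ.filter fun i : Fin 5 => y i = i).card = 0 ∧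
          (Finset.univ.filter fun i : Fin 5 => (y ^ 2) i = i).card = 2} : Set (Perm (Fin 5))) := hy
      rw [if_neg hy']
      exact key
  obtain ⟨L, hL, h⟩ := exists_frobenius_mem_of_oneSided_symmetric 5 11 12 12 one_lt_five' (by norm_num)
    H hH {y : Perm (Fin 5) | (Finset.univ.filter fun i : Fin 5 => y i = i).card = 0 ∧
      (Finset.univ.filter fun i : Fin 5 => (y ^ 2) i = i).card = 2} hpt'
  refine ⟨L, hL, fun K _ _ h5 hS5 => ?_⟩
  obtain ⟨p, hp, hpx, hdvd, σ, hσ, hfix⟩ := h K h5 hS5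
  refine ⟨p, hp, hpx, hdvd, splittingType_eq_two_three h5 hp hdvd ?_ ?_⟩
  · rw [hfix 1, pow_one]; exact hσ.1
  · rw [hfix 2]; exact hσ.2

end Summit.QuantumAdvantage.QuantumAdvantage.Theorems.DegreeOnePrimesEscape

end
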